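import Summits.FinalStateConjecture.FinalStateConjecture.Theorems.EIHFluxBalanceInertialRecessionSlavingAxisData

/-!
# Route EIHFluxBalance — `InertialRecession` (E′), stub `stub_frozenVacuumSlaving` (K1): Kerr–Schild
# data and first derivatives at rest-frame TANGENT points `(t, x, a, 0)` (all spins)

Helper file for the crux `stmt-FinalStateConjecture-17403` (evidence note `K1_tangent_points_structure.md`).
At a point `y = (t, x, a, 0)`, `x > 0`, of the equatorial plane — where the Kerr–Schild null congruence (straight
null lines tangent to the cylinders) runs along `∂₁` — the data are Schwarzschild-simple for EVERY spin `a`: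
`ρ² = x² + a²`, discriminant `x⁴`, `r = x`, `Σ = x²`, `ℓ = (1, 1, 0, 0)`, `H = M/x`; first derivatives
`∂r = (0, 1, a/x, 0)`, `∂_c ℓ_μ = 0` except `∂₂ℓ₂ = ∂₃ℓ₃ = 1/x`, `∂H = (0, −M/x², −Ma/x³, 0)` (the spin enters
the first jet only through `∂₂ r` and `∂₂ H`). These points (and their images under the axial rotations by `π/2`)
are the evaluation events at which the momentum rows of the slaving stub are polynomial in `a`. Twin of
`…SlavingAxisData`; Literature + that file only; no definitions, no `sorry`. [folklore]
-/

set_option linter.dupNamespace false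

noncomputable section

open scoped Topology
open Filter Set Function Literature.Geometry.Lorentzian Literature.Geometry.Lorentzian.Kerr

namespace Summit.FinalStateConjecture.FinalStateConjecture.Theorems.SublinearIsFree.Slaving

section Tangent

variable {M a : ℝ} {y : E4} (h2 : y 2 = a) (h3 : y 3 = 0) (hx : 0 < y 1)
include h2 h3

/-- `ρ² = x² + a²` at a tangent point. [folklore] -/
theorem tangent_spatialNorm_sq : E4.spatialNorm y ^ 2 = y 1 ^ 2 + a ^ 2 := by
  rw [E4.spatialNorm_sq, h2, h3]; ring

/-- The discriminant at a tangent point is `x⁴`. [folklore] -/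
theorem tangent_radiusDiscr : radiusDiscr a y = (y 1 ^ 2) ^ 2 := by
  unfold radiusDiscr; rw [tangent_spatialNorm_sq h2 h3, h3]; ring

include hx

/-- **At a tangent point `r = x`.** [folklore] -/
theorem tangent_radius : radius a y = y 1 := by
  rw [radius_eq, tangent_radiusDiscr h2 h3, tangent_spatialNorm_sq h2 h3,
    Real.sqrt_sq (sq_nonneg _)]
  rw [show (y 1 ^ 2 + a ^ 2 - a ^ 2 + y 1 ^ 2) / 2 = y 1 ^ 2 by ring, Real.sqrt_sq hx.le]

/-- At a tangent point `r > 0`. [folklore] -/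
theorem tangent_radius_pos : 0 < radius a y := by rw [tangent_radius h2 h3 hx]; exact hx

/-- `Σ = x²` at a tangent point. [folklore] -/
theorem tangent_blSigma : blSigma a (E4.spatial y) = y 1 ^ 2 := by
  unfold blSigma
  rw [radius_ofTimeSpace_spatial, tangent_radius h2 h3 hx]
  have : ‖E4.spatial y‖ ^ 2 = y 1 ^ 2 + a ^ 2 := tangent_spatialNorm_sq h2 h3
  rw [this]; ring

/-- `ℓ = (1, 1, 0, 0)` at a tangent point. [folklore] -/
theorem tangent_nullCovectorFun : nullCovectorFun a y = ![1, 1, 0, 0] := by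
  have hr := tangent_radius h2 h3 hx
  have hS : y 1 ^ 2 + a ^ 2 ≠ 0 := by positivity
  funext μ
  fin_cases μ
  · simp [nullCovectorFun]
  · have h1 : nullCovectorFun a y 1 = 1 := by
      rw [nullCovectorFun_apply_one, hr, h2, div_eq_one_iff_eq hS]; ring
    simpa using h1
  · simp [nullCovectorFun_apply_two, hr, h2]; left; ring
  · simp [nullCovectorFun_apply_three, h3]

/-- `H = M/x` at a tangent point. [folklore] -/
theorem tangent_scalarH : scalarH M a y = M / y 1 := by
  unfold scalarH
  rw [tangent_radius h2 h3 hx, h3]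
  have hx0 : y 1 ≠ 0 := hx.ne'
  field_simp
  ring

/-- `∂r = (0, 1, a/x, 0)` at a tangent point. [folklore] -/
theorem tangent_fderiv_radius (c : Fin 4) :
    fderiv ℝ (radius a) y (E4.basisVector c) = ![0, 1, a / y 1, 0] c := by
  have hr0 := tangent_radius_pos h2 h3 hx
  have hr := tangent_radius h2 h3 hx
  have hSig := tangent_blSigma h2 h3 hx
  have hx0 : y 1 ≠ 0 := hx.ne'
  fin_cases c
  · have hd : DifferentiableAt ℝ (radius a) y :=
      (contDiffAt_radius hr0 (n := 1)).differentiableAt one_ne_zero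
    have hl : HasLineDerivAt ℝ (radius a) 0 y (E4.basisVector 0) := by
      show HasDerivAt (fun t : ℝ ↦ radius a (y + t • E4.basisVector 0)) 0 0
      have : (fun t : ℝ ↦ radius a (y + t • E4.basisVector 0)) = fun _ ↦ radius a y :=
        funext fun t ↦ radius_add_time_smul_basisVector a y t
      rw [this]; exact hasDerivAt_const _ _
    simpa using (hd.hasFDerivAt.hasLineDerivAt (E4.basisVector 0)).unique hl
  · show fderiv ℝ (radius a) y (E4.basisVector 1) = 1
    rw [fderiv_radius_basisVector_one hr0, hSig, hr]
    field_simp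
  · show fderiv ℝ (radius a) y (E4.basisVector 2) = a / y 1
    rw [fderiv_radius_basisVector_two hr0, hSig, hr, h2]
    field_simp
  · show fderiv ℝ (radius a) y (E4.basisVector 3) = 0
    rw [fderiv_radius_basisVector_three hr0, h3]; simp

/-- `∂_c ℓ_μ` at a tangent point: zero except `∂₂ℓ₂ = ∂₃ℓ₃ = 1/x`. [folklore] -/
theorem tangent_fderiv_nullCovectorFun (c μ : Fin 4) :
    fderiv ℝ (fun z ↦ nullCovectorFun a z μ) y (E4.basisVector c) =
      ![![0, 0, 0, 0], ![0, 0, 0, 0], ![0, 0, (y 1)⁻¹, 0], ![0, 0, 0, (y 1)⁻¹]] c μ := by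
  have hr0 := tangent_radius_pos h2 h3 hx
  have hr := tangent_radius h2 h3 hx
  have hdr := tangent_fderiv_radius h2 h3 hx
  have hx0 : y 1 ≠ 0 := hx.ne'
  have hS : y 1 ^ 2 + a ^ 2 ≠ 0 := by positivity
  fin_cases μ
  · fin_cases c <;> simp [nullCovectorFun]
  · fin_cases c
    · simp [fderiv_nullCovectorFun_one hr0, hdr, hr, h2, E4.basisVector]
    · simp [fderiv_nullCovectorFun_one hr0, hdr, hr, h2, E4.basisVector]
      left; ring
    · simp [fderiv_nullCovectorFun_one hr0, hdr, hr, h2, E4.basisVector]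
      left; field_simp; ring
    · simp [fderiv_nullCovectorFun_one hr0, hdr, hr, h2, E4.basisVector]
  · fin_cases c
    · simp [fderiv_nullCovectorFun_two hr0, hdr, hr, h2, E4.basisVector]
    · simp [fderiv_nullCovectorFun_two hr0, hdr, hr, h2, E4.basisVector]
      left; left; ring
    · simp [fderiv_nullCovectorFun_two hr0, hdr, hr, h2, E4.basisVector]
      field_simp; ring
    · simp [fderiv_nullCovectorFun_two hr0, hdr, hr, h2, E4.basisVector]
  · fin_cases c
    · simp [fderiv_nullCovectorFun_three hr0, hdr, hr, h3, E4.basisVector]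
    · simp [fderiv_nullCovectorFun_three hr0, hdr, hr, h3, E4.basisVector]
    · simp [fderiv_nullCovectorFun_three hr0, hdr, hr, h3, E4.basisVector]
    · simp [fderiv_nullCovectorFun_three hr0, hdr, hr, h3, E4.basisVector]
      field_simp

/-- `∂H = (0, −M/x², −Ma/x³, 0)` at a tangent point. [folklore] -/
theorem tangent_fderiv_scalarH (c : Fin 4) :
    fderiv ℝ (scalarH M a) y (E4.basisVector c) = ![0, -(M / y 1 ^ 2), -(M * a / y 1 ^ 3), 0] c := by
  have hr0 := tangent_radius_pos h2 h3 hx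
  have hr := tangent_radius h2 h3 hx
  have hdr := tangent_fderiv_radius h2 h3 hx
  have hx0 : y 1 ≠ 0 := hx.ne'
  fin_cases c <;> simp [fderiv_scalarH hr0, hdr, hr, h3, E4.basisVector] <;> field_simp <;> ring

end Tangent

/-- Registered carrier `slaving_tangentData_slaving12` of the crux item (= `tangent_fderiv_scalarH`). [folklore] -/
theorem slaving_tangentData_slaving12 : open Literature.Geometry.Lorentzian in ∀ {M a : ℝ} {y : E4}, y 2 = a → y 3 = 0 → 0 < y 1 → ∀ c : Fin 4, fderiv ℝ (Kerr.scalarH M a) y (E4.basisVector c) = ![0, -(M / y 1 ^ 2), -(M * a / y 1 ^ 3), 0] c :=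
  fun h2 h3 hx c ↦ tangent_fderiv_scalarH h2 h3 hx c

end Summit.FinalStateConjecture.FinalStateConjecture.Theorems.SublinearIsFree.Slaving
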